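import Mathlib

/-!
# Second-order Rayleigh bound for the top eigenvalue under a perturbation

Kernel shadow of proof obligation (E5)(i) of census-1's interval certificate L-LAM-CERT-A
(`pub-nsfunc-census-1/exact/llam-A/L-LAM-CERT-A.md` §3).
search for candidate a priori estimates; no regularity claim.

Setting: a real inner product space `V`, a linear map `T` with a unit vector `e`, `T e = lam • e`,
`T` symmetric, and a GAP hypothesis on the orthogonal complement of `e`:
`⟪u, T u⟫ ≤ (lam - δ) ‖u‖²` whenever `⟪u, e⟫ = 0`.  A linear perturbation `E` with the bilinear bound
`|⟪x, E y⟫| ≤ ρ ‖x‖ ‖y‖` and `2ρ < δ`.  Then every unit vector `v` has Rayleigh quotient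
`⟪v, (T + E) v⟫ ≤ lam + ⟪e, E e⟫ + ρ² / (δ - 2ρ)` (`rayleigh_upper`); with the lower witness
`⟪e, (T+E) e⟫ = lam + ⟪e, E e⟫` (`rayleigh_at_eigenvector`) this pins the top of the Rayleigh
quotient of `T + E` to second order in `ρ` with the explicit constant used cell by cell in the
certificate (there `V = ℝ³`, `T = S(c)` the strain at the cell centre, `E = S(x) - S(c)`).
-/

namespace Summit.NavierStokesRegularity.FunctionalMining.TopEigPerturb

open InnerProductSpace
open scoped RealInnerProductSpace

variable {V : Type*} [NormedAddCommGroup V] [InnerProductSpace ℝ V]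

/-- Scalar core: `-(δ - 2ρ) s² + 2 ρ s ≤ ρ²/(δ - 2ρ)` for all real `s` when `2ρ < δ`. -/
theorem scalar_core (δ ρ s : ℝ) (hδ : 2 * ρ < δ) :
    -(δ - 2 * ρ) * s ^ 2 + 2 * ρ * s ≤ ρ ^ 2 / (δ - 2 * ρ) := by
  have hA : 0 < δ - 2 * ρ := by linarith
  rw [le_div_iff₀ hA]
  nlinarith [sq_nonneg ((δ - 2 * ρ) * s - ρ)]

/-- Lower witness: the Rayleigh quotient of `T + E` at the unit eigenvector `e` is `lam + ⟪e, E e⟫`. -/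
theorem rayleigh_at_eigenvector (T E : V →ₗ[ℝ] V) (e : V) (lam : ℝ)
    (he : ‖e‖ = 1) (hTe : T e = lam • e) :
    ⟪e, (T + E) e⟫ = lam + ⟪e, E e⟫ := by
  have hee : ⟪e, e⟫ = (1 : ℝ) := by
    rw [real_inner_self_eq_norm_sq, he]; norm_num
  rw [LinearMap.add_apply, inner_add_right, hTe, real_inner_smul_right, hee, mul_one]

/-- Pythagoras for the decomposition `v = c • e + u`, `u ⊥ e`, `‖e‖ = 1`. -/
theorem norm_sq_decomp (e u : V) (c : ℝ) (he : ‖e‖ = 1) (hue : ⟪u, e⟫ = (0 : ℝ)) :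
    ‖c • e + u‖ ^ 2 = c ^ 2 + ‖u‖ ^ 2 := by
  have hee : ⟪e, e⟫ = (1 : ℝ) := by rw [real_inner_self_eq_norm_sq, he]; norm_num
  have heu : ⟪e, u⟫ = (0 : ℝ) := by rw [real_inner_comm]; exact hue
  rw [← real_inner_self_eq_norm_sq, inner_add_left, inner_add_right, inner_add_right,
    real_inner_smul_left, real_inner_smul_left, real_inner_smul_right, real_inner_smul_right,
    hee, heu, hue, real_inner_self_eq_norm_sq]
  ring

/-- Upper bound (second order, explicit constant): for every unit vector `v`,
`⟪v, (T+E) v⟫ ≤ lam + ⟪e, E e⟫ + ρ²/(δ - 2ρ)`. -/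
theorem rayleigh_upper (T E : V →ₗ[ℝ] V) (e : V) (lam δ ρ : ℝ)
    (he : ‖e‖ = 1) (hTe : T e = lam • e)
    (hTsymm : ∀ x y : V, ⟪T x, y⟫ = ⟪x, T y⟫)
    (hgap : ∀ u : V, ⟪u, e⟫ = (0 : ℝ) → ⟪u, T u⟫ ≤ (lam - δ) * ‖u‖ ^ 2)
    (hρ : 0 ≤ ρ) (hδ : 2 * ρ < δ)
    (hE : ∀ x y : V, |⟪x, E y⟫| ≤ ρ * ‖x‖ * ‖y‖)
    (v : V) (hv : ‖v‖ = 1) :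
    ⟪v, (T + E) v⟫ ≤ lam + ⟪e, E e⟫ + ρ ^ 2 / (δ - 2 * ρ) := by
  obtain ⟨c, hc⟩ : ∃ c : ℝ, c = ⟪v, e⟫ := ⟨_, rfl⟩
  obtain ⟨u, hu⟩ : ∃ u : V, u = v - c • e := ⟨_, rfl⟩
  have hee : ⟪e, e⟫ = (1 : ℝ) := by rw [real_inner_self_eq_norm_sq, he]; norm_num
  have hue : ⟪u, e⟫ = (0 : ℝ) := by
    rw [hu, inner_sub_left, real_inner_smul_left, hee, ← hc]; ring
  have heu : ⟪e, u⟫ = (0 : ℝ) := by rw [real_inner_comm]; exact hue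
  have hv_dec : v = c • e + u := by rw [hu]; abel
  have hnorm : c ^ 2 + ‖u‖ ^ 2 = 1 := by
    rw [← norm_sq_decomp e u c he hue, ← hv_dec, hv]; norm_num
  -- the T part
  have hTu_e : ⟪e, T u⟫ = (0 : ℝ) := by
    rw [← hTsymm, hTe, real_inner_smul_left, heu, mul_zero]
  have hT : ⟪v, T v⟫ = c ^ 2 * lam + ⟪u, T u⟫ := by
    rw [hv_dec, map_add, map_smul, hTe, inner_add_left, inner_add_right, inner_add_right,
      real_inner_smul_left, real_inner_smul_left, real_inner_smul_right, real_inner_smul_right,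
      smul_smul, real_inner_smul_right, hee, hue, hTu_e]
    ring
  have hTbound : ⟪v, T v⟫ ≤ lam - δ * ‖u‖ ^ 2 := by
    have h1 := hgap u hue
    have hc2 : c ^ 2 = 1 - ‖u‖ ^ 2 := by linarith
    rw [hT, hc2]
    nlinarith [h1]
  -- the E part
  have hEv : ⟪v, E v⟫ = c ^ 2 * ⟪e, E e⟫ + c * ⟪e, E u⟫ + c * ⟪u, E e⟫ + ⟪u, E u⟫ := by
    rw [hv_dec, map_add, map_smul, inner_add_left, inner_add_right, inner_add_right,
      real_inner_smul_left, real_inner_smul_left, real_inner_smul_right, real_inner_smul_right]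
    ring
  have hnu : 0 ≤ ‖u‖ := norm_nonneg u
  have hcabs : |c| ≤ 1 := by
    rw [abs_le]; constructor <;> nlinarith [hnorm, sq_nonneg ‖u‖, sq_nonneg (c - 1), sq_nonneg (c + 1)]
  have h_ee : |⟪e, E e⟫| ≤ ρ := by
    have := hE e e; rw [he, mul_one, mul_one] at this; exact this
  have h_eu : |⟪e, E u⟫| ≤ ρ * ‖u‖ := by
    have := hE e u; rw [he, mul_one] at this; exact this
  have h_ue : |⟪u, E e⟫| ≤ ρ * ‖u‖ := by
    have := hE u e; rw [he, mul_one] at this; exact this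
  have h_uu : |⟪u, E u⟫| ≤ ρ * ‖u‖ ^ 2 := by
    have := hE u u; rw [sq, ← mul_assoc]; exact this
  have e1 : c * ⟪e, E u⟫ ≤ |c| * (ρ * ‖u‖) :=
    calc c * ⟪e, E u⟫ ≤ |c * ⟪e, E u⟫| := le_abs_self _
      _ = |c| * |⟪e, E u⟫| := abs_mul _ _
      _ ≤ |c| * (ρ * ‖u‖) := by gcongr
  have e2 : c * ⟪u, E e⟫ ≤ |c| * (ρ * ‖u‖) :=
    calc c * ⟪u, E e⟫ ≤ |c * ⟪u, E e⟫| := le_abs_self _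
      _ = |c| * |⟪u, E e⟫| := abs_mul _ _
      _ ≤ |c| * (ρ * ‖u‖) := by gcongr
  have e3 : ⟪u, E u⟫ ≤ ρ * ‖u‖ ^ 2 := le_trans (le_abs_self _) h_uu
  have e4 : c ^ 2 * ⟪e, E e⟫ ≤ ⟪e, E e⟫ + ρ * ‖u‖ ^ 2 := by
    have hc2 : c ^ 2 = 1 - ‖u‖ ^ 2 := by linarith
    have hlo : -ρ ≤ ⟪e, E e⟫ := (abs_le.mp h_ee).1
    rw [hc2]
    nlinarith [sq_nonneg ‖u‖, hlo]
  have e5 : |c| * (ρ * ‖u‖) ≤ ρ * ‖u‖ := by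
    have h0 : 0 ≤ ρ * ‖u‖ := mul_nonneg hρ hnu
    nlinarith [abs_nonneg c, hcabs, h0]
  have key : ⟪v, (T + E) v⟫ ≤ lam + ⟪e, E e⟫ + (-(δ - 2 * ρ) * ‖u‖ ^ 2 + 2 * ρ * ‖u‖) := by
    rw [LinearMap.add_apply, inner_add_right, hEv]
    linarith [hTbound, e1, e2, e3, e4, e5]
  have sc := scalar_core δ ρ ‖u‖ hδ
  linarith


/-- sin-θ bound (proof obligation (E2), first half): if `q` is a unit vector whose Rayleigh quotient
`⟪q, T q⟫` exceeds the bound `lam2` of `T` on `e^⊥`, then the component of `q` orthogonal to the unit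
eigenvector `e` has norm at most `‖T q - ⟪q,Tq⟫ • q‖ / (⟪q,Tq⟫ - lam2)`. -/
theorem sin_theta_bound (T : V →ₗ[ℝ] V) (e q : V) (lam lam2 : ℝ)
    (he : ‖e‖ = 1) (hTe : T e = lam • e)
    (hgap : ∀ u : V, ⟪u, e⟫ = (0 : ℝ) → ⟪u, T u⟫ ≤ lam2 * ‖u‖ ^ 2)
    (hq : lam2 < ⟪q, T q⟫) :
    ‖q - ⟪q, e⟫ • e‖ ≤ ‖T q - ⟪q, T q⟫ • q‖ / (⟪q, T q⟫ - lam2) := by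
  obtain ⟨c, hc⟩ : ∃ c : ℝ, c = ⟪q, e⟫ := ⟨_, rfl⟩
  obtain ⟨u, hu⟩ : ∃ u : V, u = q - c • e := ⟨_, rfl⟩
  obtain ⟨r, hr⟩ : ∃ r : V, r = T q - ⟪q, T q⟫ • q := ⟨_, rfl⟩
  have hee : ⟪e, e⟫ = (1 : ℝ) := by rw [real_inner_self_eq_norm_sq, he]; norm_num
  have hue : ⟪u, e⟫ = (0 : ℝ) := by
    rw [hu, inner_sub_left, real_inner_smul_left, hee, ← hc]; ring
  have heu : ⟪e, u⟫ = (0 : ℝ) := by rw [real_inner_comm]; exact hue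
  have hq_dec : q = c • e + u := by rw [hu]; abel
  have hTu_e : ⟪u, T e⟫ = (0 : ℝ) := by rw [hTe, real_inner_smul_right, hue, mul_zero]
  -- ⟪u, q⟫ = ‖u‖²
  have huq : ⟪u, q⟫ = ‖u‖ ^ 2 := by
    rw [hq_dec, inner_add_right, real_inner_smul_right, hue, mul_zero, zero_add,
      real_inner_self_eq_norm_sq]
  -- ⟪u, T q⟫ = ⟪u, T u⟫
  have huTq : ⟪u, T q⟫ = ⟪u, T u⟫ := by
    rw [hq_dec, map_add, map_smul, inner_add_right, real_inner_smul_right, hTu_e, mul_zero, zero_add]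
  -- key: (ρ - lam2) ‖u‖² ≤ -⟪u, r⟫ ≤ ‖u‖ ‖r‖
  have hur : ⟪u, r⟫ = ⟪u, T u⟫ - ⟪q, T q⟫ * ‖u‖ ^ 2 := by
    rw [hr, inner_sub_right, real_inner_smul_right, huTq, huq]
  have hpos : 0 < ⟪q, T q⟫ - lam2 := by linarith
  have h1 : (⟪q, T q⟫ - lam2) * ‖u‖ ^ 2 ≤ ‖u‖ * ‖r‖ := by
    have hg := hgap u hue
    have hcs : -⟪u, r⟫ ≤ ‖u‖ * ‖r‖ := by
      have := abs_real_inner_le_norm u r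
      have := neg_abs_le ⟪u, r⟫
      linarith
    rw [hur] at hcs
    nlinarith [hg, hcs]
  rw [← hc, ← hu, ← hr, le_div_iff₀ hpos]
  by_cases h0 : ‖u‖ = 0
  · rw [h0, zero_mul]; positivity
  · have hupos : 0 < ‖u‖ := lt_of_le_of_ne (norm_nonneg u) (Ne.symm h0)
    have h2 : (⟪q, T q⟫ - lam2) * ‖u‖ ≤ ‖r‖ := by
      have := h1
      rw [sq, ← mul_assoc, mul_comm ‖u‖ ‖r‖] at this
      exact le_of_mul_le_mul_right this hupos
    linarith [h2]

/-- Tangent-line (convexity) inequality for powers, used in (E6): for `0 ≤ t`, `0 < t₀`,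
`t ^ n ≥ t₀ ^ n + n * t₀ ^ (n-1) * (t - t₀)`. -/
theorem pow_tangent_line (t t₀ : ℝ) (n : ℕ) (ht : 0 ≤ t) (ht₀ : 0 < t₀) (hn : 1 ≤ n) :
    t₀ ^ n + n * t₀ ^ (n - 1) * (t - t₀) ≤ t ^ n := by
  -- Bernoulli: (1 + x)^n ≥ 1 + n x for x ≥ -2 (Mathlib: one_add_mul_le_pow with -2 ≤ x)
  have hx : (-2 : ℝ) ≤ t / t₀ - 1 := by
    have : 0 ≤ t / t₀ := div_nonneg ht (le_of_lt ht₀)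
    linarith
  have hB := one_add_mul_le_pow hx n
  have h1 : (1 : ℝ) + (t / t₀ - 1) = t / t₀ := by ring
  rw [h1, div_pow] at hB
  have hpow : 0 < t₀ ^ n := pow_pos ht₀ n
  have hB' := mul_le_mul_of_nonneg_right hB (le_of_lt hpow)
  rw [div_mul_cancel₀ _ (ne_of_gt hpow)] at hB'
  have hsplit : t₀ ^ n = t₀ * t₀ ^ (n - 1) := by
    rw [← pow_succ']; congr 1; omega
  calc t₀ ^ n + n * t₀ ^ (n - 1) * (t - t₀)
      = (1 + n * (t / t₀ - 1)) * t₀ ^ n := by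
        rw [hsplit]; field_simp
    _ ≤ t ^ n := hB'

end Summit.NavierStokesRegularity.FunctionalMining.TopEigPerturb
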